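import Summits.CriticalPhenomena.CardyFormulaZ2.Theorems.CardyIKTransportIKLinearTransportStubStripDiagramExchangePart1
import Summits.CriticalPhenomena.CardyFormulaZ2.Theorems.CardyIKTransportIKLinearTransportStubPinnedSamplerUniform
import Summits.CriticalPhenomena.CardyFormulaZ2.Theorems.CardyIKTransportIKLinearTransportStubPinnedSamplerTransfer

/-!
# Stub `stub_PinnedSampler` (line `pinned-diagram-exchange`, crux stmt-CriticalPhenomena-5076) —
# part M: measurability of the pinned statistic and the DIAGRAM-PINNED RESAMPLER without locality

Registered sub-goal `ps_exists_pinned_resampler_of_stripDiagramExchange` (`--supports stmt-CriticalPhenomena-5076`):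
GIVEN `StripDiagramExchange S i` there is a jointly measurable `G : Obs → Rnd → Obs` which (clause 2 of
`PinnedSampler`) rewrites only the middle data — `eraseMid i` preserved SURELY —, (clause 3) preserves the
strip diagram `stripDiagram i` SURELY, for ALL inputs including atypical ones, and (clause 5) transports
`νmix S ⊗ β` to `νmix (S ∆ {i, i+1})`. This is the SATISFIABILITY AUDIT of the predicate `PinnedSampler`
asked by the lead: clauses 1, 2, 3, 5 are jointly satisfiable given the neighbour stub
`stub_StripDiagramExchange`; what the registered stub adds is the sure vertical covariance (clause 4) and
the exponential quasi-locality with uniform constants (clause 6) — the research content (strong spatial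
mixing in mean of the diagram-conditioned middle column + a covariant finitary coding), untouched here.

Ingredients: `ps_beta_uniform` (part U, p94321: uniform levels from the fresh bits),
`ps_exists_fibrewise_resampler` (part T, p94331: condCDF disintegration + conditional quantile transform on
the standard Borel space `Obs`), the measurability of `eraseMid i` (`measurable_eraseMid`, landed part 1 of
the neighbour stub `stub_StripDiagramExchange`) and of `stripDiagram i` proved below (reachability inside the
induced 3-column strip graph is a countable union over vertex lists of finite Boolean combinations of
coordinates).

Second registered sub-goal `ps_pinnedSampler_of_ae` (NULL-SET UPGRADE): a measurable candidate preserving the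
pinned statistic ALMOST surely and vertically covariant ALMOST surely (plus law transport and quasi-locality)
yields a `PinnedSampler` with the same constants, all clauses sure — identity off the shift-invariant
full-measure core (shift-invariance of `νmix S ⊗ β`: `nuMix_map_vshift`, `beta_map_ushift`, p84275). So the
remaining research content (strong spatial mixing in mean of the diagram-conditioned middle column + a
covariant finitary coding) only owes almost-sure versions of clauses 2–4.
-/

noncomputable section

namespace Summit.CriticalPhenomena.CardyFormulaZ2.Theorems.IKLinearTransport.PinnedDiagramExchange

open scoped Classical MeasureTheory ENNReal ProbabilityTheory symmDiff
open Set MeasureTheory ProbabilityTheory Filter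
open Literature.Probability.Percolation Literature.Probability.LatticeModels

/-! ## Measurability of the pinned statistic `(eraseMid i, stripDiagram i)` -/

/-- Adjacency in the random triangulation `cellGraph A` is a measurable function of the anti-diagonal
set `A`. [folklore] -/
theorem ps_measurable_cellGraph_adj (u w : Site 2) :
    Measurable fun A : Set (Site 2) => (cellGraph A).Adj u w := by
  have key : ∀ a b : Site 2, Measurable fun A : Set (Site 2) =>
      b = a + ![1, 0] ∨ b = a + ![0, 1] ∨ (b = a + ![1, 1] ∧ a ∉ A) ∨
        (b = a + ![1, -1] ∧ (a + ![0, -1]) ∈ A) := fun a b =>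
    measurable_const.or (measurable_const.or ((measurable_const.and (measurable_set_mem a).not).or
      (measurable_const.and (measurable_set_mem _))))
  simp only [cellGraph, SimpleGraph.fromRel_adj, ne_eq]
  exact measurable_const.and ((key u w).or (key w u))

/-- Being a chain for a measurably varying relation is measurable, for every fixed list. [folklore] -/
theorem ps_measurable_isChain {X V : Type*} [MeasurableSpace X] {R : X → V → V → Prop}
    (hR : ∀ a b, Measurable fun x => R x a b) : ∀ l : List V, Measurable fun x => List.IsChain (R x) l
  | [] => by simp
  | [a] => by simp
  | a :: b :: t => by
    simp only [List.isChain_cons_cons]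
    exact (hR a b).and (ps_measurable_isChain hR (b :: t))

/-- Reachability inside an induced subgraph = a chain of the ambient graph through the inducing set
(vertex lists, so that the event becomes a countable union). [folklore] -/
theorem ps_reachable_induce_iff {V : Type*} (G : SimpleGraph V) (s : Set V) :
    ∀ {u v : V} (hu : u ∈ s) (hv : v ∈ s),
      (G.induce s).Reachable ⟨u, hu⟩ ⟨v, hv⟩ ↔ ∃ l : List V, List.IsChain G.Adj (u :: l) ∧
        (u :: l).getLast (List.cons_ne_nil u l) = v ∧ ∀ w ∈ l, w ∈ s := by
  -- from a chain to a walk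
  have back : ∀ (l : List V) (u v : V) (hu : u ∈ s) (hv : v ∈ s), List.IsChain G.Adj (u :: l) →
      (u :: l).getLast (List.cons_ne_nil u l) = v → (∀ w ∈ l, w ∈ s) →
      (G.induce s).Reachable ⟨u, hu⟩ ⟨v, hv⟩ := by
    intro l
    induction l with
    | nil =>
      intro u v hu hv _ hlast _
      simp only [List.getLast_singleton] at hlast
      subst hlast
      exact SimpleGraph.Reachable.refl _
    | cons w t ih =>
      intro u v hu hv hc hlast hs
      have huw : G.Adj u w := (List.isChain_cons_cons.1 hc).1
      have hw : w ∈ s := hs w List.mem_cons_self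
      have hreach := ih w v hw hv (List.isChain_cons_cons.1 hc).2
        (by simpa [List.getLast_cons (List.cons_ne_nil w t)] using hlast)
        (fun w' hw' => hs w' (List.mem_cons_of_mem _ hw'))
      have hadj : (G.induce s).Adj ⟨u, hu⟩ ⟨w, hw⟩ := huw
      exact hadj.reachable.trans hreach
  intro u v hu hv
  constructor
  · rintro ⟨W⟩
    -- the ambient walk and its support
    set W' := W.map (SimpleGraph.Embedding.induce s).toHom with hW'
    refine ⟨W'.support.tail, ?_, ?_, ?_⟩
    · have := W'.isChain_adj_support
      rwa [← W'.cons_tail_support] at this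
    · have key : ∀ (L : List V) (hL : L ≠ []), L = W'.support → L.getLast hL = v := by
        rintro L hL rfl
        exact W'.getLast_support
      exact key _ _ W'.cons_tail_support
    · intro w hw
      have hw' : w ∈ W'.support := by
        rw [← W'.cons_tail_support]; exact List.mem_cons_of_mem _ hw
      rw [hW', SimpleGraph.Walk.support_map] at hw'
      obtain ⟨a, -, rfl⟩ := List.mem_map.1 hw'
      exact a.2
  · rintro ⟨l, hc, hlast, hs⟩
    exact back l u v hu hv hc hlast hs

/-- Membership in the strip diagram, unfolded into a countable union of finite-dimensional events. [folklore] -/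
theorem ps_mem_stripDiagram_iff (i : ℤ) (x : Obs) (pq : Site 2 × Site 2) :
    pq ∈ stripDiagram i x ↔ (pq.1 0 = i ∨ pq.1 0 = i + 2) ∧ (pq.2 0 = i ∨ pq.2 0 = i + 2) ∧
      ((pq.2 ∈ x.1 ↔ pq.1 ∈ x.1) ∧ i ≤ pq.2 0 ∧ pq.2 0 ≤ i + 2) ∧ (i ≤ pq.1 0 ∧ pq.1 0 ≤ i + 2) ∧
      ∃ l : List (Site 2), List.IsChain (cellGraph x.2).Adj (pq.1 :: l) ∧
        (pq.1 :: l).getLast (List.cons_ne_nil _ _) = pq.2 ∧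
        ∀ w ∈ l, (w ∈ x.1 ↔ pq.1 ∈ x.1) ∧ i ≤ w 0 ∧ w 0 ≤ i + 2 := by
  simp only [stripDiagram, mem_setOf_eq]
  constructor
  · rintro ⟨h1, h2, h, h1', hr⟩
    exact ⟨h1, h2, h, h1', (ps_reachable_induce_iff _ _ _ _).1 hr⟩
  · rintro ⟨h1, h2, h, h1', hl⟩
    exact ⟨h1, h2, h, h1', (ps_reachable_induce_iff _ _ _ _).2 hl⟩

/-- `stripDiagram i` is measurable. [folklore] -/
theorem ps_measurable_stripDiagram (i : ℤ) : Measurable (stripDiagram i) := by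
  refine measurable_set_iff.2 fun pq => ?_
  simp_rw [ps_mem_stripDiagram_iff]
  have hcol : ∀ a b : Site 2, Measurable fun x : Obs => (a ∈ x.1 ↔ b ∈ x.1) := fun a b =>
    ((measurable_set_mem a).comp measurable_fst).iff ((measurable_set_mem b).comp measurable_fst)
  refine measurable_const.and (measurable_const.and (((hcol _ _).and measurable_const).and
    (measurable_const.and (Measurable.exists fun l => ?_))))
  refine (ps_measurable_isChain (fun a b => (ps_measurable_cellGraph_adj a b).comp measurable_snd)
    (pq.1 :: l)).and (measurable_const.and (Measurable.forall fun w => Measurable.imp measurable_const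
      ((hcol _ _).and measurable_const)))

/-! ## From almost sure to sure: the null-set upgrade for `PinnedSampler` -/

/-- Vertical shifts of observables compose additively. [folklore] -/
theorem ps_vshift_vshift (m k : ℤ) (x : Obs) : vshift m (vshift k x) = vshift (m + k) x := by
  have hv : ∀ v : Site 2, v - ![0, m] - ![0, k] = v - ![0, m + k] := fun v => by
    ext j; fin_cases j <;> simp [sub_sub] <;> rfl
  refine Prod.ext ?_ ?_ <;> ext v <;> simp only [vshift, Set.mem_preimage, hv]

/-- Vertical shifts of the fresh randomness compose additively. [folklore] -/
theorem ps_ushift_ushift (m k : ℤ) (u : Rnd) : ushift m (ushift k u) = ushift (m + k) u := by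
  have hv : ∀ v : Site 2, v - ![0, m] - ![0, k] = v - ![0, m + k] := fun v => by
    ext j; fin_cases j <;> simp [sub_sub] <;> rfl
  ext q; simp only [ushift, Set.mem_setOf_eq, hv]

/-- The zero shift is the identity on observables. [folklore] -/
theorem ps_vshift_zero (x : Obs) : vshift 0 x = x := by
  have hv : ∀ v : Site 2, v - ![0, 0] = v := fun v => by
    ext j; fin_cases j <;> simp
  refine Prod.ext ?_ ?_ <;> ext v <;> simp only [vshift, Set.mem_preimage, hv]

/-- The zero shift is the identity on the fresh randomness. [folklore] -/
theorem ps_ushift_zero (u : Rnd) : ushift 0 u = u := by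
  have hv : ∀ v : Site 2, v - ![0, 0] = v := fun v => by
    ext j; fin_cases j <;> simp
  ext q; simp only [ushift, Set.mem_setOf_eq, hv, Prod.mk.eta]

/-- NULL-SET UPGRADE: a measurable candidate which preserves the pinned statistic ALMOST SURELY, is vertically
covariant ALMOST SURELY, transports the law and is quasi-local, yields a `PinnedSampler` with the SAME
constants (all clauses sure): replace it by the identity off the shift-invariant full-measure set where all
its shifts behave (`νmix S ⊗ β` is shift-invariant: `nuMix_map_vshift`, `beta_map_ushift`). So a proof of
`stub_PinnedSampler` only owes almost-sure versions of clauses 2–4. [folklore] -/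
theorem ps_pinnedSampler_of_ae :
    ∀ (C c : ℝ) (S : Set ℤ) (i : ℤ) (G₁ : Obs → Rnd → Obs), Measurable (Function.uncurry G₁) →
      (∀ᵐ xu ∂((νmix S).prod β), eraseMid i (G₁ xu.1 xu.2) = eraseMid i xu.1 ∧
        stripDiagram i (G₁ xu.1 xu.2) = stripDiagram i xu.1) →
      (∀ᵐ xu ∂((νmix S).prod β), ∀ m : ℤ,
        G₁ (vshift m xu.1) (ushift m xu.2) = vshift m (G₁ xu.1 xu.2)) →
      (StripDiagramExchange S i →
        ((νmix S).prod β).map (Function.uncurry G₁) = νmix (symmDiff S {i, i + 1})) →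
      (∀ (v : Site 2) (r : ℕ), ∃ Gloc : Obs → Rnd → Obs,
        (∀ (x x' : Obs) (u u' : Rnd),
          (∀ w ∈ ballInf v (2 * r), (w ∈ x.1 ↔ w ∈ x'.1) ∧ (w ∈ x.2 ↔ w ∈ x'.2) ∧
            ∀ k : ℕ, ((w, k) ∈ u ↔ (w, k) ∈ u')) →
          ∀ w ∈ ballInf v r, (w ∈ (Gloc x u).1 ↔ w ∈ (Gloc x' u').1) ∧
            (w ∈ (Gloc x u).2 ↔ w ∈ (Gloc x' u').2)) ∧
        ((νmix S).prod β) {xu | ∃ w ∈ ballInf v r,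
            ¬ ((w ∈ (G₁ xu.1 xu.2).1 ↔ w ∈ (Gloc xu.1 xu.2).1) ∧
               (w ∈ (G₁ xu.1 xu.2).2 ↔ w ∈ (Gloc xu.1 xu.2).2))} ≤
          ENNReal.ofReal (C * Real.exp (-c * r))) →
      ∃ G : Obs → Rnd → Obs, PinnedSampler C c S i G := by
  intro C c S i G₁ hm hπ hcov hlaw hloc
  haveI : StandardBorelSpace (Set (Site 2)) := inferInstanceAs (StandardBorelSpace (Site 2 → Prop))
  haveI : StandardBorelSpace (Set (Site 2 × Site 2)) :=
    inferInstanceAs (StandardBorelSpace (Site 2 × Site 2 → Prop))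
  haveI : IsProbabilityMeasure β := by
    rw [show β = sitePercolation (Site 2 × ℕ) half from rfl]; infer_instance
  haveI := isProbabilityMeasure_nuMix S
  obtain ⟨μ, hμ⟩ : ∃ μ : Measure (Obs × Rnd), μ = (νmix S).prod β := ⟨_, rfl⟩
  -- the shifts of the product space preserve `μ`
  obtain ⟨T, hT⟩ : ∃ T : ℤ → Obs × Rnd → Obs × Rnd, T = fun m xu => (vshift m xu.1, ushift m xu.2) :=
    ⟨_, rfl⟩
  have hTm : ∀ m, Measurable (T m) := fun m => by
    rw [hT]; exact (measurable_vshift m).prodMap (measurable_ushift m)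
  have hTμ : ∀ m, μ.map (T m) = μ := fun m => by
    have hTm' : T m = Prod.map (vshift m) (ushift m) := by rw [hT]; rfl
    rw [hTm', hμ, ← Measure.map_prod_map _ _ (measurable_vshift m) (measurable_ushift m),
      nuMix_map_vshift, beta_map_ushift]
  have hTT : ∀ m k xu, T m (T k xu) = T (m + k) xu := fun m k xu => by
    simp only [hT, ps_vshift_vshift, ps_ushift_ushift]
  have hT0 : ∀ xu, T 0 xu = xu := fun xu => by
    simp only [hT, ps_vshift_zero, ps_ushift_zero, Prod.mk.eta]
  -- the good set and its shift-invariant core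
  obtain ⟨Good, hGood⟩ : ∃ Good : Set (Obs × Rnd), Good = {xu | (eraseMid i (G₁ xu.1 xu.2) =
      eraseMid i xu.1 ∧ stripDiagram i (G₁ xu.1 xu.2) = stripDiagram i xu.1) ∧
      ∀ m : ℤ, G₁ (vshift m xu.1) (ushift m xu.2) = vshift m (G₁ xu.1 xu.2)} := ⟨_, rfl⟩
  have hGoodm : MeasurableSet Good := by
    rw [hGood]
    refine ((measurableSet_eq_fun ((measurable_eraseMid i).comp hm)
      ((measurable_eraseMid i).comp measurable_fst)).inter
      (measurableSet_eq_fun ((ps_measurable_stripDiagram i).comp hm)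
      ((ps_measurable_stripDiagram i).comp measurable_fst))).inter ?_
    refine measurableSet_setOf.2 (Measurable.forall fun m => measurableSet_setOf.1 ?_)
    exact measurableSet_eq_fun (hm.comp ((measurable_vshift m).prodMap (measurable_ushift m)))
      ((measurable_vshift m).comp hm)
  have hGoodae : ∀ᵐ xu ∂μ, xu ∈ Good := by
    rw [hμ]
    filter_upwards [hπ, hcov] with xu h1 h2
    rw [hGood]
    exact ⟨h1, h2⟩
  obtain ⟨𝒢, h𝒢⟩ : ∃ 𝒢 : Set (Obs × Rnd), 𝒢 = ⋂ m : ℤ, T m ⁻¹' Good := ⟨_, rfl⟩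
  have hmem𝒢 : ∀ xu, xu ∈ 𝒢 ↔ ∀ m, T m xu ∈ Good := fun xu => by rw [h𝒢]; simp
  have h𝒢m : MeasurableSet 𝒢 := by
    rw [h𝒢]; exact MeasurableSet.iInter fun m => hGoodm.preimage (hTm m)
  have h𝒢ae : ∀ᵐ xu ∂μ, xu ∈ 𝒢 := by
    simp_rw [hmem𝒢]
    refine ae_all_iff.2 fun m => ?_
    have h1 : ∀ᵐ y ∂(μ.map (T m)), y ∈ Good := by rw [hTμ m]; exact hGoodae
    exact ae_of_ae_map (hTm m).aemeasurable h1
  have h𝒢null : μ 𝒢ᶜ = 0 := by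
    have := ae_iff.1 h𝒢ae
    simpa only [Set.compl_def] using this
  have hinv : ∀ m xu, xu ∈ 𝒢 → T m xu ∈ 𝒢 := fun m xu h => by
    rw [hmem𝒢] at h ⊢
    intro k
    rw [hTT]
    exact h (k + m)
  have hinv' : ∀ m xu, T m xu ∈ 𝒢 → xu ∈ 𝒢 := fun m xu h => by
    have := hinv (-m) _ h
    rwa [hTT, neg_add_cancel, hT0] at this
  have hgood_of : ∀ xu, xu ∈ 𝒢 → xu ∈ Good := fun xu h => by
    have := (hmem𝒢 xu).1 h 0
    rwa [hT0] at this
  have hTapp : ∀ m (x : Obs) (u : Rnd), T m (x, u) = (vshift m x, ushift m u) := fun m x u => by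
    rw [hT]
  -- the repaired sampler
  obtain ⟨G, hG⟩ : ∃ G : Obs → Rnd → Obs, G = fun x u => if (x, u) ∈ 𝒢 then G₁ x u else x := ⟨_, rfl⟩
  have hGin : ∀ x u, (x, u) ∈ 𝒢 → G x u = G₁ x u := fun x u h => by rw [hG]; exact if_pos h
  have hGout : ∀ x u, (x, u) ∉ 𝒢 → G x u = x := fun x u h => by rw [hG]; exact if_neg h
  have hGin' : ∀ xu : Obs × Rnd, xu ∈ 𝒢 → G xu.1 xu.2 = G₁ xu.1 xu.2 := fun xu h =>
    hGin _ _ (by rwa [Prod.mk.eta])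
  refine ⟨G, ?_, ?_, ?_, ?_, ?_, ?_⟩
  · rw [hG]
    exact Measurable.ite (h𝒢m.preimage (measurable_fst.prodMk measurable_snd)) hm measurable_fst
  · intro x u
    by_cases h : (x, u) ∈ 𝒢
    · have := hgood_of _ h; rw [hGood] at this; rw [hGin x u h]; exact this.1.1
    · rw [hGout x u h]
  · intro x u
    by_cases h : (x, u) ∈ 𝒢
    · have := hgood_of _ h; rw [hGood] at this; rw [hGin x u h]; exact this.1.2
    · rw [hGout x u h]
  · intro m x u
    by_cases h : (x, u) ∈ 𝒢
    · have h' : (vshift m x, ushift m u) ∈ 𝒢 := by rw [← hTapp]; exact hinv m _ h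
      rw [hGin _ _ h', hGin _ _ h]
      have := hgood_of _ h; rw [hGood] at this; exact this.2 m
    · have h' : (vshift m x, ushift m u) ∉ 𝒢 := fun h' => h (hinv' m _ (by rw [hTapp]; exact h'))
      rw [hGout _ _ h', hGout _ _ h]
  · intro hX
    have hae : Function.uncurry G =ᵐ[(νmix S).prod β] Function.uncurry G₁ := by
      rw [← hμ]
      filter_upwards [h𝒢ae] with xu hxu
      exact hGin' xu hxu
    rw [Measure.map_congr hae]
    exact hlaw hX
  · intro v r
    obtain ⟨Gloc, hGloc, hbound⟩ := hloc v r
    refine ⟨Gloc, hGloc, ?_⟩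
    rw [← hμ] at hbound ⊢
    calc μ {xu : Obs × Rnd | ∃ w ∈ ballInf v r,
            ¬((w ∈ (G xu.1 xu.2).1 ↔ w ∈ (Gloc xu.1 xu.2).1) ∧ (w ∈ (G xu.1 xu.2).2 ↔ w ∈ (Gloc xu.1 xu.2).2))}
        ≤ μ ({xu | ∃ w ∈ ballInf v r, ¬((w ∈ (G₁ xu.1 xu.2).1 ↔ w ∈ (Gloc xu.1 xu.2).1) ∧
            (w ∈ (G₁ xu.1 xu.2).2 ↔ w ∈ (Gloc xu.1 xu.2).2))} ∪ 𝒢ᶜ) := by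
          refine measure_mono fun xu hxu => ?_
          by_cases h : xu ∈ 𝒢
          · left
            rw [Set.mem_setOf_eq, hGin' xu h] at hxu
            exact hxu
          · right; exact h
      _ ≤ μ {xu | ∃ w ∈ ballInf v r, ¬((w ∈ (G₁ xu.1 xu.2).1 ↔ w ∈ (Gloc xu.1 xu.2).1) ∧
            (w ∈ (G₁ xu.1 xu.2).2 ↔ w ∈ (Gloc xu.1 xu.2).2))} + μ 𝒢ᶜ := measure_union_le _ _
      _ ≤ ENNReal.ofReal (C * Real.exp (-c * r)) := by rw [h𝒢null, add_zero]; exact hbound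

/-! ## The diagram-pinned resampler (clauses 1, 2, 3, 5 of `PinnedSampler`) -/

/-- DIAGRAM-PINNED RESAMPLER WITHOUT LOCALITY (registered sub-goal; the satisfiability audit of
`PinnedSampler`): given `StripDiagramExchange S i`, a jointly measurable `G : Obs → Rnd → Obs` preserving
`eraseMid i` and `stripDiagram i` SURELY and transporting `νmix S ⊗ β` to `νmix (S ∆ {i, i+1})` — the
conditional law of the middle data given (off-column observables, strip diagram) under the exchanged
pattern, sampled by a conditional quantile transform at a uniform level read from the fresh bits, with the
identity as fallback on the null set where the disintegration misses the fibre. [folklore] -/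
theorem ps_exists_pinned_resampler_of_stripDiagramExchange :
    ∀ (S : Set ℤ) (i : ℤ), StripDiagramExchange S i → ∃ G : Obs → Rnd → Obs,
      Measurable (Function.uncurry G) ∧ (∀ x u, eraseMid i (G x u) = eraseMid i x) ∧
      (∀ x u, stripDiagram i (G x u) = stripDiagram i x) ∧
      ((νmix S).prod β).map (Function.uncurry G) = νmix (symmDiff S {i, i + 1}) := by
  intro S i hX
  obtain ⟨U, hUm, -, -, hunif⟩ := ps_beta_uniform
  have hπ : Measurable fun x : Obs => (eraseMid i x, stripDiagram i x) :=
    (measurable_eraseMid i).prodMk (ps_measurable_stripDiagram i)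
  obtain ⟨G, hGm, hGπ, hGlaw⟩ := ps_exists_fibrewise_resampler _ hπ (νmix S) (νmix (S ∆ {i, i + 1}))
    (isProbabilityMeasure_nuMix S) (isProbabilityMeasure_nuMix _) hX (U 0) (hUm 0) (hunif 0)
  exact ⟨G, hGm, fun x u => (Prod.ext_iff.1 (hGπ x u)).1, fun x u => (Prod.ext_iff.1 (hGπ x u)).2, hGlaw⟩

end Summit.CriticalPhenomena.CardyFormulaZ2.Theorems.IKLinearTransport.PinnedDiagramExchange
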